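import Summits.ABC.IUTFork.Conditional.Layer5OfSEx51
import Literature.IUT.HodgeTheaters.GlobalFrobenioidsCoricLawsNonVacuity
import Literature.IUT.HodgeTheaters.GlobalFrobenioidsCyclotomesZHatModel
import HarnessLib

/-!
# Layer-5 certificate, row `IUTchI:Ex5.1(v)` — the HYPOTHESIS LIST of `layer5_held_ex51v` is JOINTLY INHABITED
# (vacuity guard; proof-only; the certificate theorem FIRES at one explicit datum)

Cell abc-iut, director-abc (C2) layer certificates; `Summits/ABC/IUTFork/Conditional/Layer5OfSEx51.lean` (v0.1,
abc-iut-L5-d2 / abc-iut-w5-d110), theorem `Summit.ABC.IUTFork.Conditional.layer5_held_ex51v`: 1 FACT binder (F-2571)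
+ 21 LAW binders over 17 data atoms ⊢ 8 closed conjuncts for [IUTchI] Example 5.1 (v) (kurims manuscript May 2020,
pp. 127–129) [claim: Mochizuki2012, status: disputed].  A certificate row whose hypothesis list were unsatisfiable
would prove its conjuncts vacuously; abc-iut-w5-d110 showed (`NFBridgeRecon.not_laws_of_commutative`, p432142) that the
N-side block has no model with commutative `π₁^rat(†𝒟^⊛)`.  This file records, in the kernel, that the FULL
hypothesis list (all 22 binders, over one choice of the 17 data atoms) IS inhabited, and that the certificate theorem
applies to the inhabitant BY NAME (so the witness shapes are exactly the certificate's binder shapes):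

* N-side block (F-2571, (a), (a×), (b′), (b′×), pole/zero/polex/zerox, moves) — abc-iut-w4-d050's NON-ABELIAN toy
  `NFBridgeRecon.CoricLawsToy.exists_ex51v_binders_v1` (`GlobalFrobenioidsCoricLawsNonVacuity.lean`, p437599:
  `π₁^rat := S₃`, `K_rat := Frac ℚ[x₀,x₁,x₂]`, container `Ẑ × ℤ³`);
* `†𝕄^⊛`-display block (E)(T)(V)(I)(P) — abc-iut's `CyclotomeComparisonFamily.exists_zhatModel_integral_laws`
  (`GlobalFrobenioidsCyclotomesZHatModel.lean`) at the tree's REAL `Ẑ^× = Aut(Ẑ)`, layer `AstLayer.mod`;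
* ∞κ cyclotome block (E)(T)(D)(Ctwo)(Cone) — `exists_zhat_comparison_laws` below: both cyclotomes and both containers
  the REAL `Ẑ`, image `η(ℤ_{>0})` (orders at a zero), `zμ u e := u ∘ e` (the genuine torsor law (T) with `u := e′e⁻¹`),
  `twist u := u`, `ordC := η⁻¹` at two points.

`layer5_held_ex51v_inhabited`: ∃ (the 17 data atoms at universes `0`), (the 22 hypotheses) ∧ (the 8 conclusions) —
the conclusions obtained by APPLYING `layer5_held_ex51v` to the hypotheses.

HONEST FRAMING.  DEGENERATE TOY data (genuine side = the tree's REAL `Ẑ` / `Ẑ^×`); this is a VACUITY GUARD for OUR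
certificate's assumption labels — not a discharge of any binder, not a claim about the genuine `Gal(L̄_C/L_C)`-datum,
nothing of [IUTchI] asserted or denied; no side is taken on [IUTchIII] Cor. 3.12; typed ≠ inhabited ≠ discharged.
PROOF-ONLY: no `def`, no `instance`, no `structure`, no new Prop fact; nothing of the certificate modules is edited.
-/

namespace Summit.ABC.IUTFork.Conditional

open Literature.IUT.HodgeTheaters ProfiniteGrp ProfiniteGrp.ProfiniteCompletion
open Literature.AnabelianGeometry.EtaleTheta Literature.AnabelianGeometry.EtaleTheta.ZHatLevel

/-- **The ∞κ cyclotome-comparison block (E)(T)(D)(Ctwo)(Cone) at the REAL `Ẑ`.**  With both cyclotomes and both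
containers `Ẑ`, image `η(ℤ_{>0})`, `induced e := e`, `zμ u e := u ∘ e`, `twist u := u` and `ordC := η⁻¹` at two points,
every hypothesis of `UniqueCyclotomeIso.of_laws` in the shape used by `layer5_held_ex51v` holds (law (T) by the genuine
simply-transitive action, `u := e′ ∘ e⁻¹`). ([IUTchI] Ex 5.1 (v) pp.127–128) [claim: Mochizuki2012, status: disputed] -/
theorem exists_zhat_comparison_laws :
    ∃ (C : CyclotomeComparison.{0})
      (zμ : MulAut (completion (GrpCat.of (Multiplicative ℤ))) → (C.μ₁ ≃* C.μ₂) → (C.μ₁ ≃* C.μ₂))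
      (twist : MulAut (completion (GrpCat.of (Multiplicative ℤ))) → C.H₂ → C.H₂)
      (ordC : Fin 2 → C.H₂ → ℤ),
      (∀ e, zμ 1 e = e) ∧
      (∃ e₀ : C.μ₁ ≃* C.μ₂, Set.BijOn (C.induced e₀) C.im₁ C.im₂) ∧
      (∀ e e' : C.μ₁ ≃* C.μ₂, ∃ u : MulAut (completion (GrpCat.of (Multiplicative ℤ))),
        e' = zμ u e ∧ ∀ h, C.induced e' h = twist u (C.induced e h)) ∧
      (∀ u : MulAut (completion (GrpCat.of (Multiplicative ℤ))), Set.MapsTo (twist u) C.im₂ C.im₂ →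
        ∀ h ∈ C.im₂, ∀ x : Fin 2, u (eta (ordC x h)) = eta (ordC x (twist u h))) ∧
      (∃ h ∈ C.im₂, ∃ x₁ x₂ : Fin 2, x₁ ≠ x₂ ∧ 0 < ordC x₁ h ∧ 0 < ordC x₂ h) ∧
      (∀ h ∈ C.im₂, ∀ x₁ x₂ : Fin 2, x₁ ≠ x₂ → ¬ (ordC x₁ h < 0 ∧ ordC x₂ h < 0)) := by
  classical
  let zhatCommGroup : CommGroup (completion (GrpCat.of (Multiplicative ℤ))) :=
    { (inferInstance : Group (completion (GrpCat.of (Multiplicative ℤ)))) with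
      mul_comm := Literature.AnabelianGeometry.AbsoluteAnabelian.ZHatCompletion.mul_comm }
  let val : completion (GrpCat.of (Multiplicative ℤ)) → ℤ :=
    fun h => if hh : h ∈ Set.range eta then hh.choose else 0
  have hval_eta : ∀ d : ℤ, val (eta d) = d := by
    intro d
    have hh : eta d ∈ Set.range eta := ⟨d, rfl⟩
    have h1 : val (eta d) = hh.choose := dif_pos hh
    rw [h1]
    exact CyclotomeIsoIntegralLawsToy.eta_injective hh.choose_spec
  let C : CyclotomeComparison.{0} :=
    { μ₁ := completion (GrpCat.of (Multiplicative ℤ)), μ₂ := completion (GrpCat.of (Multiplicative ℤ)),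
      grp₁ := zhatCommGroup, grp₂ := zhatCommGroup,
      H₁ := completion (GrpCat.of (Multiplicative ℤ)), H₂ := completion (GrpCat.of (Multiplicative ℤ)),
      im₁ := eta '' {d : ℤ | 0 < d}, im₂ := eta '' {d : ℤ | 0 < d},
      induced := fun e h => e h }
  have h01 : (0 : Fin 2) ≠ 1 := by decide
  refine ⟨C, fun u e => e.trans u, fun u h => u h, fun _ => val, fun e => MulEquiv.ext fun _ => rfl,
    ⟨MulEquiv.refl _, Set.bijOn_id _⟩, ?_, ?_, ?_, ?_⟩
  · -- (T): the genuine torsor law, `u := e′ ∘ e⁻¹`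
    intro e e'
    refine ⟨e.symm.trans e', MulEquiv.ext fun h => ?_, fun h => ?_⟩
    · change e' h = e' (e.symm (e h))
      rw [e.symm_apply_apply]
    · change e' h = e' (e.symm (e h))
      rw [e.symm_apply_apply]
  · -- (D): divisor transport for the genuine twist
    rintro u hu h ⟨d, hd, rfl⟩ -
    obtain ⟨d', -, hd'⟩ := hu ⟨d, hd, rfl⟩
    have hd'' : eta d' = u (eta d) := hd'
    change u (eta (val (eta d))) = eta (val (u (eta d)))
    rw [hval_eta, ← hd'', hval_eta]
  · -- (Ctwo): `η 1` has order `1` at both points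
    refine ⟨eta 1, ⟨1, show (0 : ℤ) < 1 from one_pos, rfl⟩, 0, 1, h01, ?_, ?_⟩ <;>
    · change 0 < val (eta 1)
      rw [hval_eta]; exact one_pos
  · -- (Cone): orders on the image are positive
    rintro h ⟨d, hd, rfl⟩ x₁ x₂ _ ⟨h1, -⟩
    change val (eta d) < 0 at h1
    rw [hval_eta] at h1
    exact absurd hd (not_lt.2 h1.le)

/-- **The hypothesis list of `layer5_held_ex51v` is jointly inhabited, and the certificate fires there.**  There is
ONE choice of the 17 data atoms of `Summit.ABC.IUTFork.Conditional.layer5_held_ex51v` (at universes `0`) at which all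
22 binders (F-2571 + 21 laws) hold simultaneously — N-side block: abc-iut-w4-d050's non-abelian `S₃` toy; ∞κ
comparison block: `exists_zhat_comparison_laws`; `†𝕄^⊛`-display block: the REAL-`Ẑ^×` family of
`CyclotomeComparisonFamily.exists_zhatModel_integral_laws` — and, at that choice, the EIGHT closed conjuncts of the
row, obtained by applying `layer5_held_ex51v` itself to the witnesses (shape check by name).  DEGENERATE TOY; vacuity
guard only. ([IUTchI] Ex 5.1 (v) pp.127–129) [claim: Mochizuki2012, status: disputed] -/
theorem layer5_held_ex51v_inhabited :
    ∃ (N : NFBridgeRecon.{0}) (H : Type) (_ : CommGroup H) (_ : MulAction N.piRat H)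
      (_ : MulAction (MulAut (completion (GrpCat.of (Multiplicative ℤ)))) H)
      (κ : N.infκPair.KummerRealization H) (κx : N.infκxPair.KummerRealization H)
      (X : Type) (ord : X → N.Krat → ℤ)
      (C : CyclotomeComparison.{0})
      (zμ : MulAut (completion (GrpCat.of (Multiplicative ℤ))) → (C.μ₁ ≃* C.μ₂) → (C.μ₁ ≃* C.μ₂))
      (twist : MulAut (completion (GrpCat.of (Multiplicative ℤ))) → C.H₂ → C.H₂)
      (Pt : Type) (ordC : Pt → C.H₂ → ℤ)
      (𝔓 : Type) (Cf : CyclotomeComparisonFamily.{0, 0, 0} AstLayer 𝔓)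
      (zμf : MulAut (completion (GrpCat.of (Multiplicative ℤ))) → (Cf.μ₁ ≃* Cf.μ₂) → (Cf.μ₁ ≃* Cf.μ₂))
      (twistf : MulAut (completion (GrpCat.of (Multiplicative ℤ))) → Cf.H₂ → Cf.H₂)
      (val : 𝔓 → Cf.H₂ → ℤ),
      -- the 22 hypotheses of `layer5_held_ex51v`, verbatim
      (N.MκIsInvariants ∧
      (∀ e : CoricPair.Iso N.infκPair N.infκPair,
        ∃ u : MulAut (completion (GrpCat.of (Multiplicative ℤ))),
          ∀ x : N.infκPair.carrier, κ.toFun (e.toEquiv x) = u • κ.toFun x) ∧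
      (∀ e : CoricPair.Iso N.infκxPair N.infκxPair,
        ∃ u : MulAut (completion (GrpCat.of (Multiplicative ℤ))),
          ∀ x : N.infκxPair.carrier, κx.toFun (e.toEquiv x) = u • κx.toFun x) ∧
      (∀ (u : MulAut (completion (GrpCat.of (Multiplicative ℤ)))) (f f' : N.infκPair.carrier),
        (f : N.Krat) ∈ N.Mκ → (f' : N.Krat) ∈ N.Mκ → κ.toFun f' = u • κ.toFun f →
        ∀ x : X, u (eta (ord x f)) = eta (ord x f')) ∧
      (∀ (u : MulAut (completion (GrpCat.of (Multiplicative ℤ)))) (f f' : N.infκxPair.carrier),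
        (∀ g : N.piRat, g • (f : N.Krat) = f) → (∀ g : N.piRat, g • (f' : N.Krat) = f') →
        κx.toFun f' = u • κx.toFun f → ∀ x : X, u (eta (ord x f)) = eta (ord x f')) ∧
      (∀ f' ∈ N.Mκ, ∀ x₁ x₂ : X, x₁ ≠ x₂ → ¬ (ord x₁ f' < 0 ∧ ord x₂ f' < 0)) ∧
      (∃ f ∈ N.Mκ, ∃ x₁ x₂ : X, x₁ ≠ x₂ ∧ 0 < ord x₁ f ∧ 0 < ord x₂ f) ∧
      (∀ f' ∈ N.Minfκx, (∀ g : N.piRat, g • f' = f') →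
        ∀ x₁ x₂ : X, x₁ ≠ x₂ → ¬ (ord x₁ f' < 0 ∧ ord x₂ f' < 0)) ∧
      (∃ f ∈ N.Minfκx, (∀ g : N.piRat, g • f = f) ∧
        ∃ x₁ x₂ : X, x₁ ≠ x₂ ∧ 0 < ord x₁ f ∧ 0 < ord x₂ f) ∧
      (∃ g ∈ N.ratKsolKer, ∃ f ∈ N.Minfκx, g • f ≠ f) ∧
      (∀ e, zμ 1 e = e) ∧
      (∃ e₀ : C.μ₁ ≃* C.μ₂, Set.BijOn (C.induced e₀) C.im₁ C.im₂) ∧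
      (∀ e e' : C.μ₁ ≃* C.μ₂, ∃ u : MulAut (completion (GrpCat.of (Multiplicative ℤ))),
        e' = zμ u e ∧ ∀ h, C.induced e' h = twist u (C.induced e h)) ∧
      (∀ u : MulAut (completion (GrpCat.of (Multiplicative ℤ))), Set.MapsTo (twist u) C.im₂ C.im₂ →
        ∀ h ∈ C.im₂, ∀ x : Pt, u (eta (ordC x h)) = eta (ordC x (twist u h))) ∧
      (∃ h ∈ C.im₂, ∃ x₁ x₂ : Pt, x₁ ≠ x₂ ∧ 0 < ordC x₁ h ∧ 0 < ordC x₂ h) ∧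
      (∀ h ∈ C.im₂, ∀ x₁ x₂ : Pt, x₁ ≠ x₂ → ¬ (ordC x₁ h < 0 ∧ ordC x₂ h < 0)) ∧
      (∀ e, zμf 1 e = e) ∧
      (∃ e, Cf.InducesCompatibleIsos e) ∧
      (∀ e e' : Cf.μ₁ ≃* Cf.μ₂, ∃ u : MulAut (completion (GrpCat.of (Multiplicative ℤ))),
        e' = zμf u e ∧ ∀ h, Cf.induced e' h = twistf u (Cf.induced e h)) ∧
      (∀ u : MulAut (completion (GrpCat.of (Multiplicative ℤ))),
        Set.MapsTo (twistf u) (Cf.im₂ AstLayer.mod) (Cf.im₂ AstLayer.mod) →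
          ∀ h ∈ Cf.im₂ AstLayer.mod, ∀ 𝔭 : 𝔓, u (eta (val 𝔭 h)) = eta (val 𝔭 (twistf u h))) ∧
      (∀ 𝔭 : 𝔓, ∀ h ∈ Cf.im₂ AstLayer.mod, h ∈ Cf.int₂ 𝔭 → 0 ≤ val 𝔭 h) ∧
      (∃ 𝔭₀ : 𝔓, ∃ h ∈ Cf.im₂ AstLayer.mod, h ∈ Cf.int₂ 𝔭₀ ∧ 0 < val 𝔭₀ h)) ∧
      -- the 8 closed conjuncts of the row, AT this datum (the certificate applied)
      (ExistsUniqueCoricStructure N.piRat N.infκPair ∧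
      ExistsUniqueCoricStructure N.piRat N.infκxPair ∧
      UniqueCyclotomeIso C ∧
      UniqueCyclotomeIsoFamily Cf ∧
      (∀ P : CoricPair N.piRat, IsCoricStructure N.piRat N.infκPair P → P.FactorsThrough N.ratKsolKer) ∧
      (∀ P : CoricPair N.piRat, IsCoricStructure N.piRat N.infκxPair P → ¬ P.FactorsThrough N.ratKsolKer) ∧
      (∀ P P' : CoricPair N.piRat, ∀ (h : IsCoricStructure N.piRat N.infκPair P)
        (h' : IsCoricStructure N.piRat N.infκPair P'),
        ∃! e : CoricPair.Iso P P',
          e.IsCompatible (CoricPair.KummerRealization.ofIso h.nonempty_iso.some κ)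
            (CoricPair.KummerRealization.ofIso h'.nonempty_iso.some κ)) ∧
      N.minfκUnits ⊆ N.minfκxUnits) := by
  obtain ⟨N, H, i₁, i₂, i₃, κ, κx, X, ord, -, hF, hnat, hnatx, hord, hordx, hpole, hzero, hpolex, hzerox, hmoves⟩ :=
    NFBridgeRecon.CoricLawsToy.exists_ex51v_binders_v1
  obtain ⟨C, zμ, twist, ordC, hzμ, hE, hT, hD, hCtwo, hCone⟩ := exists_zhat_comparison_laws
  obtain ⟨Cf, zμf, twistf, val, -, hzμf, hfE, hfT, hfV, hfI, hfP, -, -⟩ :=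
    CyclotomeComparisonFamily.exists_zhatModel_integral_laws AstLayer Unit AstLayer.mod
  exact ⟨N, H, i₁, i₂, i₃, κ, κx, X, ord, C, zμ, twist, Fin 2, ordC, Unit, Cf, zμf, twistf, val,
    ⟨hF, hnat, hnatx, hord, hordx, hpole, hzero, hpolex, hzerox, hmoves, hzμ, hE, hT, hD, hCtwo, hCone, hzμf, hfE,
      hfT, hfV, hfI, hfP⟩,
    layer5_held_ex51v N hF H κ κx hnat hnatx ord hord hordx hpole hzero hpolex hzerox hmoves C zμ hzμ twist hE hT
      ordC hD hCtwo hCone Cf zμf hzμf twistf hfE hfT val hfV hfI hfP⟩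

end Summit.ABC.IUTFork.Conditional
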